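import Mathlib
import HarnessLib
import Literature.Geometry.Lorentzian.KerrConvergence
import Literature.Geometry.Lorentzian.KerrSchildCoord

/-!
# Route StarvedNecks — crux `FutureOrientedOfSeamed` (stmt-FinalStateConjecture-17576), line `Sketch`:
# stub `stub_continuousW`

Continuity of the transported Kerr–Schild time field `W(y) = Λ V_{M,a}(Λ⁻¹(y − c))` on the
boosted, translated Kerr exterior `boostedKerrExterior Λ c M a = {y | Λ⁻¹(y − c) ∈ Kerr.exterior M a}`:
the inverse Poincaré map `y ↦ Λ⁻¹(y − c)` is continuous (`continuous_poincareInv`), the time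
vector `x ↦ V_x = e₀ − 2H ℓ♯` is real-analytic, in particular continuous, at every point with
`r > 0` (`Kerr.contDiffAt_timeVector`), which holds on the exterior
(`Kerr.radius_pos_of_mem_region`), and `Λ` is a continuous linear map.

References: M. Dafermos, I. Rodnianski, *Lectures on black holes and linear waves*,
arXiv:0811.0354, §5.1 (`V = −∇t*` on `{r > 0}`); B. O'Neill, *Semi-Riemannian geometry*, 1983,
Ch. 9 (Lorentz and Poincaré transformations).
-/

noncomputable section

set_option linter.dupNamespace false

open Set Filter Topology Function
open scoped Manifold ContDiff ENNReal Topology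
open Literature.Geometry.Lorentzian

namespace Summit.FinalStateConjecture.FinalStateConjecture.Theorems.FutureOrientedOfSeamed.ClockDualityRays

/-- **Continuity of the rest-frame Kerr time field at a point with `r > 0` after a Poincaré
motion.** For a Lorentz transformation `Λ`, a translation `c` and a point `y` whose rest-frame
image `Λ⁻¹(y − c)` has Kerr–Schild radius `r > 0`, the map `y ↦ Λ V_{M,a}(Λ⁻¹(y − c))` is
continuous at `y`: composition of the continuous affine map `poincareInv Λ c`, the time vector
`V`, analytic at points with `r > 0` (Dafermos–Rodnianski arXiv:0811.0354, §5.1), and the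
continuous linear map `Λ`. [folklore] -/
theorem continuousAt_boostedTimeVector (M a : ℝ) (Λ : lorentzGroup) (c : E4) {y : E4}
    (hy : 0 < Kerr.radius a (poincareInv Λ c y)) :
    ContinuousAt (fun y : E4 ↦ (Λ : E4 ≃L[ℝ] E4) (Kerr.timeVector M a (poincareInv Λ c y))) y :=
  (Λ : E4 ≃L[ℝ] E4).continuous.continuousAt.comp
    ((Kerr.contDiffAt_timeVector M a hy (n := 0)).continuousAt.comp
      (continuous_poincareInv Λ c).continuousAt)

/-- **Stub (continuity of the transported Kerr time field).** The transported Kerr–Schild time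
field `W(y) = Λ V_{M,a}(Λ⁻¹(y − c))` is continuous on the boosted, translated Kerr exterior
`{y | Λ⁻¹(y − c) ∈ Kerr.exterior M a}`: at each such `y` the rest-frame point has `r > r₊ ≥ 0`,
hence `r > 0` (`Kerr.radius_pos_of_mem_region`), where `V` is analytic
(`Kerr.contDiffAt_timeVector`); compose with the continuous maps `poincareInv Λ c` and `Λ`.
Dafermos–Rodnianski arXiv:0811.0354, §5.1. [folklore] -/
theorem stub_continuousW (M a : ℝ) (Λ : lorentzGroup) (c : E4) :
    ContinuousOn (fun y : E4 ↦ (Λ : E4 ≃L[ℝ] E4) (Kerr.timeVector M a (poincareInv Λ c y)))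
      (boostedKerrExterior Λ c M a : Set E4) := fun _ hy ↦
  (continuousAt_boostedTimeVector M a Λ c
    (Kerr.radius_pos_of_mem_region (mem_boostedKerrExterior.1 hy))).continuousWithinAt

end Summit.FinalStateConjecture.FinalStateConjecture.Theorems.FutureOrientedOfSeamed.ClockDualityRays

end
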